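import Summits.BirchSwinnertonDyer.BirchSwinnertonDyer.Theorems.ByReductionTypeAtTwoAdditiveSelmerBaseChangeTransport
import Literature.NumberTheory.EllipticCurves.LocalRestrictionDegree
import HarnessLib

/-!
# Route ByReductionTypeAtTwo, crux `AdditivePotMultOverKAtTwo` (stmt-BirchSwinnertonDyer-22618) — Selmer base change
# along a finite Galois `L/K` at an infinite level, II: the reverse inclusion and THE ISOMORPHISM
# `Sel_{p^∞}(E_L/L̄^{H′}) ≃+ Sel_{p^∞}(E/K̄^{galImage H′})`, `conj`-equivariant

Cell `bsd-2adic`, seat `bsd-2adic-t42` GEN 24 (Stage B of memo `t42/DESIGN-T42-ADDENDUM-27.md` §A27.3). Sequel of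
`…AdditiveSelmerBaseChangeTransport` (`subgroupModelIso` carries `Sel^L_{H′}` into `Sel^K_{galImage H′}`). HONEST FRAMING
(D-0036 / D-0054): one definition (the packaged isomorphism, no new notion) + theorems; Galois-cohomology bookkeeping;
types-the-object-of; closes none; nothing booked; BSD is not proved by any of this. PARTITION: X5@2 additive, C4″ 22618
(−1)/(−2)-split-twist blocks × `p = 2` (the consumer); the content is for ANY number fields `K ⊆ L` (`L/K` Galois), ANY
`W/K`, `p`, and ANY normal `H′ ≤ Γ_L` with `galImage H′` normal in `Γ_K`.

* §1 `mem_localKerOverOfEmb_of_forall_tower` — the reverse local step: for `K`-fields `E₁ → E₂` with `E₂/E₁` algebraic,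
  `E₂` an `L`-field, and an `L`-embedding `ι′ : L̄ → Ē₂`: if `subgroupModelIso x` dies at EVERY `K`-embedding
  `K̄ → Ē₁`, then `x` dies at `ι′`. Proof: an `E₁`-embedding `ι₂ : Ē₁ → Ē₂` exists and is bijective (both are
  algebraic closures of `E₁`), so `ι′ ∘ ι_L = ι₂ ∘ ι₁` for the `K`-embedding `ι₁ = ι₂⁻¹ ∘ ι′ ∘ ι_L`; the condition at
  `(E₁, ι₁)` implies the condition at `(E₂, ι₂ ∘ ι₁)` (p701196's `localKerOverOfEmb_le_of_tower`: restriction to the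
  smaller group `Γ_{E₂} → Γ_{E₁}`), which is the `L`-side condition at `ι′` (`mem_localKerOverOfEmb_iff_subgroupModelIso_mem`).
* §2 `forall_mem_localKerOverOfEmb_of_forall_conjH1` — the `∀ σ, conj_σ` form of a local condition gives it at every
  embedding (`exists_algHom_eq_comp`, `localKerOverOfEmb_comp`).
* §3 finite places of `L` (`w ∣ v = w ∩ 𝓞 K`, `K_v → L_w` the tree's `adicCompletionMap`, `L_w/K_v` finite), §4 infinite
  places (`v = w ∘ (K → L)`, Mathlib's `LiesOver` completion algebra).
* §5 **`mem_selmerGroupOver_of_subgroupModelIso_mem`**: `subgroupModelIso x ∈ Sel^K_{galImage H′} → x ∈ Sel^L_{H′}`.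
* §6 **`selmerModelIso : Sel^L_{H′} ≃+ Sel^K_{galImage H′}`** (the restriction of `subgroupModelIso`), with
  `coe_selmerModelIso_apply` and the `conj`-equivariance `coe_selmerModelIso_conjH1`
  (`Θ(conj_σ x) = conj_{resGal σ}(Θ x)`, from `subgroupModelIso_conjH1`).

References: [SerreGaloisCohomology1997] I.§2.4–2.5, II.§1.1; [GreenbergLNM1716] §2; [NeukirchANT1999] II.§8; [Mazur1972] §6.
-/

set_option autoImplicit false
-- the summit's namespace `Summit.BirchSwinnertonDyer.BirchSwinnertonDyer` (Sub = Summit) trips `dupNamespace`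
set_option linter.dupNamespace false

noncomputable section

open scoped Classical NumberField.LiesOver

open NumberField IsDedekindDomain Literature.NumberTheory.EllipticCurves
  Literature.NumberTheory.EllipticCurves.BaseChangeModel
  Summit.BirchSwinnertonDyer.Rank1Residual.Additive.LocalTransport

universe u

namespace Summit.BirchSwinnertonDyer.BirchSwinnertonDyer.Theorems.SelmerBaseChange

variable {K : Type u} [Field K] [NumberField K] (L : Type u) [Field L] [NumberField L] [Algebra K L]
  (H' : Subgroup (Field.absoluteGaloisGroup L)) [H'.Normal] (W : WeierstrassCurve K) (p : ℕ)

/-! ## §1 The reverse local step along a tower `E₁ → E₂` -/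

section Tower

variable {E₁ : Type u} [Field E₁] [Algebra K E₁] {E₂ : Type u} [Field E₂] [Algebra K E₂] [Algebra L E₂]
  [IsScalarTower K L E₂] [Algebra E₁ E₂] [IsScalarTower K E₁ E₂] [Algebra.IsAlgebraic E₁ E₂]

omit [H'.Normal] in
/-- **Reverse local step.** For `K`-fields `E₁ → E₂` with `E₂/E₁` algebraic (`E₂` an `L`-field) and an `L`-embedding
`ι′ : L̄ → Ē₂`: if `subgroupModelIso x` dies at every `K`-embedding `K̄ → Ē₁`, then `x` dies at `ι′` — through the
bijective `E₁`-embedding `ι₂ : Ē₁ → Ē₂` and `ι₁ = ι₂⁻¹ ∘ ι′ ∘ ι_L`, the tower inclusion `LK(E₁, ι₁) ≤ LK(E₂, ι₂ ∘ ι₁)`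
and the correspondence of local conditions under the subgroup model. [cite: SerreGaloisCohomology1997, II.§1.1]
[cite: GreenbergLNM1716, §2] -/
theorem mem_localKerOverOfEmb_of_forall_tower (ι' : AlgebraicClosure L →ₐ[L] AlgebraicClosure E₂)
    (x : (W.baseChange L).subgroupH1 p H')
    (hx : ∀ ι : AlgebraicClosure K →ₐ[K] AlgebraicClosure E₁,
      subgroupModelIso K L H' W p x ∈ W.localKerOverOfEmb p (galImage K L H') ι) :
    x ∈ (W.baseChange L).localKerOverOfEmb p H' ι' := by
  -- `Ē₂` is algebraic over `E₁`
  haveI : IsScalarTower K E₁ (AlgebraicClosure E₂) := IsScalarTower.of_algebraMap_eq fun a ↦ by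
    rw [IsScalarTower.algebraMap_apply E₁ E₂ (AlgebraicClosure E₂), ← IsScalarTower.algebraMap_apply K E₁ E₂,
      ← IsScalarTower.algebraMap_apply]
  haveI : Algebra.IsAlgebraic E₁ (AlgebraicClosure E₂) := Algebra.IsAlgebraic.trans E₁ E₂ (AlgebraicClosure E₂)
  -- `ι₂ : Ē₁ → Ē₂` over `E₁`, bijective
  let ι₂ : AlgebraicClosure E₁ →ₐ[E₁] AlgebraicClosure E₂ := IsAlgClosed.lift
  have hι₂bij : Function.Bijective ι₂ := by
    letI : Algebra (AlgebraicClosure E₁) (AlgebraicClosure E₂) := ι₂.toRingHom.toAlgebra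
    haveI : IsScalarTower E₁ (AlgebraicClosure E₁) (AlgebraicClosure E₂) :=
      IsScalarTower.of_algebraMap_eq fun y ↦ (ι₂.commutes y).symm
    haveI : Algebra.IsAlgebraic (AlgebraicClosure E₁) (AlgebraicClosure E₂) :=
      Algebra.IsAlgebraic.tower_top (K := E₁) (AlgebraicClosure E₁)
    exact IsAlgClosed.algebraMap_bijective_of_isIntegral (k := AlgebraicClosure E₁) (K := AlgebraicClosure E₂)
  let e : AlgebraicClosure E₁ ≃ₐ[K] AlgebraicClosure E₂ := AlgEquiv.ofBijective (ι₂.restrictScalars K) hι₂bij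
  -- `ι₁ = ι₂⁻¹ ∘ ι' ∘ ι_L`
  let ι₁ : AlgebraicClosure K →ₐ[K] AlgebraicClosure E₁ :=
    (e.symm : AlgebraicClosure E₂ →ₐ[K] AlgebraicClosure E₁).comp (compEmb K L ι')
  have hcomp : (ι₂.restrictScalars K).comp ι₁ = compEmb K L ι' := by
    apply AlgHom.ext
    intro z
    change e (e.symm (compEmb K L ι' z)) = compEmb K L ι' z
    exact e.apply_symm_apply _
  have h := localKerOverOfEmb_le_of_tower W p (galImage K L H') ι₁ ι₂ (hx ι₁)
  rw [hcomp] at h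
  exact (mem_localKerOverOfEmb_iff_subgroupModelIso_mem K L H' W p ι' x).mpr h

end Tower

/-! ## §2 From the `conj_σ` form to every embedding -/

section Emb

variable {K' : Type u} [Field K'] (V : WeierstrassCurve K') (q : ℕ) (H : Subgroup (Field.absoluteGaloisGroup K'))
  [H.Normal] {E : Type u} [Field E] [Algebra K' E]

/-- If every `Γ`-conjugate of `y` dies at the chosen embedding `K̄ → K̄_E`, then `y` dies at EVERY `K`-embedding
`ι : K̄ → K̄_E` (`ι = closureEmb E ∘ τ`, and changing the embedding by `τ` conjugates the local kernel).
[cite: SerreGaloisCohomology1997, II.§1.1] [cite: GreenbergLNM1716, §2] -/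
theorem forall_mem_localKerOverOfEmb_of_forall_conjH1 (y : V.subgroupH1 q H)
    (hy : ∀ σ : Field.absoluteGaloisGroup K', V.conjH1 q H σ y ∈ V.localKerOver q H E)
    (ι : AlgebraicClosure K' →ₐ[K'] AlgebraicClosure E) : y ∈ V.localKerOverOfEmb q H ι := by
  obtain ⟨τ, rfl⟩ := exists_algHom_eq_comp (closureEmb (K := K') E) ι
  rw [V.localKerOverOfEmb_comp q H, AddSubgroup.mem_comap, ← WeierstrassCurve.localKerOver_eq_ofEmb]
  exact hy _

/-- Conversely, the condition at the embedding `closureEmb E ∘ σ` is the condition for `conj_σ y` at the chosen one.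
[cite: SerreGaloisCohomology1997, II.§1.1] -/
theorem conjH1_mem_localKerOver_of_mem_localKerOverOfEmb (y : V.subgroupH1 q H) (σ : Field.absoluteGaloisGroup K')
    (hy : y ∈ V.localKerOverOfEmb q H ((closureEmb (K := K') E).comp
      ((show AlgebraicClosure K' ≃ₐ[K'] AlgebraicClosure K' from σ) : AlgebraicClosure K' →ₐ[K'] AlgebraicClosure K'))) :
    V.conjH1 q H σ y ∈ V.localKerOver q H E := by
  rw [V.localKerOverOfEmb_comp q H, AddSubgroup.mem_comap] at hy
  rw [WeierstrassCurve.localKerOver_eq_ofEmb]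
  exact hy

end Emb

/-! ## §3 Finite places of `L` -/

section Finite

variable [(galImage K L H').Normal]

omit [H'.Normal] in
/-- **Finite places of `L`.** For `w` a finite place of `L` over `v = w ∩ 𝓞 K` and any `L`-embedding
`ι′ : L̄ → L̄_w`: if `subgroupModelIso x ∈ Sel^K_{galImage H′}` then `x` dies at `ι′` (§1 for the tower `K_v → L_w`,
`L_w/K_v` finite; §2 for the `K`-side conditions at `K_v`). [cite: GreenbergLNM1716, §2] [cite: NeukirchANT1999, II.§8] -/
theorem mem_localKerOverOfEmb_adicCompletion_of_subgroupModelIso_mem (w : HeightOneSpectrum (𝓞 L))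
    (ι' : AlgebraicClosure L →ₐ[L] AlgebraicClosure (w.adicCompletion L)) (x : (W.baseChange L).subgroupH1 p H')
    (hx : subgroupModelIso K L H' W p x ∈ W.selmerGroupOver p (galImage K L H')) :
    x ∈ (W.baseChange L).localKerOverOfEmb p H' ι' := by
  let v : HeightOneSpectrum (𝓞 K) := w.under (𝓞 K)
  haveI : w.asIdeal.LiesOver v.asIdeal := ⟨rfl⟩
  letI : Algebra (v.adicCompletion K) (w.adicCompletion L) := (adicCompletionMap (K := K) L v w).toAlgebra
  have hcoe : ∀ a : K, adicCompletionMap (K := K) L v w (algebraMap K (v.adicCompletion K) a) =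
      algebraMap L (w.adicCompletion L) (algebraMap K L a) := fun a ↦ adicCompletionMap_coe (K := K) L v w a
  haveI : IsScalarTower K (v.adicCompletion K) (w.adicCompletion L) :=
    IsScalarTower.of_algebraMap_eq fun a ↦ by
      rw [RingHom.algebraMap_toAlgebra, hcoe, ← IsScalarTower.algebraMap_apply]
  haveI : ContinuousSMul (v.adicCompletion K) (w.adicCompletion L) :=
    ⟨((continuous_adicCompletionMap w v).comp continuous_fst).mul continuous_snd⟩
  haveI : Algebra.IsAlgebraic (v.adicCompletion K) (w.adicCompletion L) := Algebra.IsAlgebraic.of_finite _ _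
  exact mem_localKerOverOfEmb_of_forall_tower L H' W p ι' x fun ι ↦
    forall_mem_localKerOverOfEmb_of_forall_conjH1 W p (galImage K L H') _
      (fun σ ↦ ((W.mem_selmerGroupOver_iff p (galImage K L H') _).1 hx).1 v σ) ι

end Finite

/-! ## §4 Infinite places of `L` -/

section Infinite

variable [(galImage K L H').Normal]

omit [H'.Normal] in
/-- **Infinite places of `L`.** For `w` an infinite place of `L` over `v = w ∘ (K → L)` and any `L`-embedding
`ι′ : L̄ → L̄_w`: if `subgroupModelIso x ∈ Sel^K_{galImage H′}` then `x` dies at `ι′` (§1 for `K_v → L_w`, Mathlib's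
`LiesOver` completion algebra, `[L_w : K_v] ≤ 2`). [cite: GreenbergLNM1716, §2] [cite: NeukirchANT1999, II.§8] -/
theorem mem_localKerOverOfEmb_infinitePlace_of_subgroupModelIso_mem (w : InfinitePlace L)
    (ι' : AlgebraicClosure L →ₐ[L] AlgebraicClosure w.Completion) (x : (W.baseChange L).subgroupH1 p H')
    (hx : subgroupModelIso K L H' W p x ∈ W.selmerGroupOver p (galImage K L H')) :
    x ∈ (W.baseChange L).localKerOverOfEmb p H' ι' := by
  let v : InfinitePlace K := w.comap (algebraMap K L)
  haveI : w.1.LiesOver v.1 := ⟨rfl⟩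
  haveI : IsScalarTower K L w.Completion := isScalarTower_completion L w
  letI : Algebra v.Completion w.Completion := NumberField.LiesOver.instAlgebraCompletion
  haveI : IsScalarTower K v.Completion w.Completion := NumberField.LiesOver.instIsScalarTowerCompletion
  haveI : FiniteDimensional v.Completion w.Completion := (finrank_completion_le_two L v w).1
  haveI : Algebra.IsAlgebraic v.Completion w.Completion := Algebra.IsAlgebraic.of_finite _ _
  exact mem_localKerOverOfEmb_of_forall_tower L H' W p ι' x fun ι ↦
    forall_mem_localKerOverOfEmb_of_forall_conjH1 W p (galImage K L H') _
      (fun σ ↦ ((W.mem_selmerGroupOver_iff p (galImage K L H') _).1 hx).2 v σ) ι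

end Infinite

/-! ## §5 `Sel^K_{galImage H′} ⊆ Θ(Sel^L_{H′})` -/

section Reverse

variable [(galImage K L H').Normal]

/-- **If `subgroupModelIso x ∈ Sel_{p^∞}(E/K̄^{galImage H′})` then `x ∈ Sel_{p^∞}(E_L/L̄^{H′})`**: every local condition
over `L` (place `w` of `L`, `Γ_L`-conjugate `σ`) is the condition at the `L`-embedding `closureEmb L_w ∘ σ`, implied by the
`K`-side conditions at the place of `K` below `w` (§3, §4). [cite: GreenbergLNM1716, §2] [cite: Mazur1972, §6] -/
theorem mem_selmerGroupOver_of_subgroupModelIso_mem (x : (W.baseChange L).subgroupH1 p H')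
    (hx : subgroupModelIso K L H' W p x ∈ W.selmerGroupOver p (galImage K L H')) :
    x ∈ (W.baseChange L).selmerGroupOver p H' := by
  rw [WeierstrassCurve.mem_selmerGroupOver_iff]
  refine ⟨fun w σ ↦ ?_, fun w σ ↦ ?_⟩
  · exact conjH1_mem_localKerOver_of_mem_localKerOverOfEmb (W.baseChange L) p H' x σ
      (mem_localKerOverOfEmb_adicCompletion_of_subgroupModelIso_mem L H' W p w _ x hx)
  · exact conjH1_mem_localKerOver_of_mem_localKerOverOfEmb (W.baseChange L) p H' x σ
      (mem_localKerOverOfEmb_infinitePlace_of_subgroupModelIso_mem L H' W p w _ x hx)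

end Reverse

/-! ## §6 The isomorphism of Selmer groups -/

section Iso

variable [IsGalois K L] [(galImage K L H').Normal]

/-- **Selmer base change along `L/K` at the level `L̄^{H′} = K̄^{galImage H′}`**:
`Sel_{p^∞}(E_L/L̄^{H′}) ≃+ Sel_{p^∞}(E/K̄^{galImage H′})`, the restriction of p701196's `subgroupModelIso` (onto by
`subgroupModelIso_mem_selmerGroupOver` and `mem_selmerGroupOver_of_subgroupModelIso_mem`). For `H′ = Gal(L̄/L·K_∞)` this
identifies the Selmer group over the top of the restricted `ℤ_p`-tower of `L` (base `L`) with the tree's subgroup model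
over `K̄^{ker κ ⊓ galRange L}` (base `K`). [cite: GreenbergLNM1716, §2] [cite: Mazur1972, §6] -/
def selmerModelIso : (W.baseChange L).selmerGroupOver p H' ≃+ W.selmerGroupOver p (galImage K L H') where
  toFun x := ⟨subgroupModelIso K L H' W p x, subgroupModelIso_mem_selmerGroupOver L H' W p x x.2⟩
  invFun y := ⟨(subgroupModelIso K L H' W p).symm y,
    mem_selmerGroupOver_of_subgroupModelIso_mem L H' W p _ (by rw [AddEquiv.apply_symm_apply]; exact y.2)⟩
  left_inv x := Subtype.ext ((subgroupModelIso K L H' W p).symm_apply_apply _)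
  right_inv y := Subtype.ext ((subgroupModelIso K L H' W p).apply_symm_apply _)
  map_add' x y := Subtype.ext (map_add _ _ _)

/-- Values of `selmerModelIso` in `H¹(galImage H′, E[p^∞])` (definitional). [cite: SerreGaloisCohomology1997, I.§2.4] -/
@[simp]
theorem coe_selmerModelIso_apply (x : (W.baseChange L).selmerGroupOver p H') :
    ((selmerModelIso L H' W p x : W.selmerGroupOver p (galImage K L H')) : W.subgroupH1 p (galImage K L H')) =
      subgroupModelIso K L H' W p x :=
  rfl

/-- Values of `selmerModelIso⁻¹` in `H¹(H′, E_L[p^∞])` (definitional). [cite: SerreGaloisCohomology1997, I.§2.4] -/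
@[simp]
theorem coe_selmerModelIso_symm_apply (y : W.selmerGroupOver p (galImage K L H')) :
    (((selmerModelIso L H' W p).symm y : (W.baseChange L).selmerGroupOver p H') : (W.baseChange L).subgroupH1 p H') =
      (subgroupModelIso K L H' W p).symm y :=
  rfl

/-- **`selmerModelIso` is `conj`-equivariant**: `Θ(conj_σ x) = conj_{resGal σ}(Θ x)` for `σ ∈ Γ_L` and `x ∈ Sel^L_{H′}`
(`Sel^L_{H′}` is `conj`-stable, `map_conjH1_selmerGroupOver_le`). [cite: SerreGaloisCohomology1997, I.§2.5]
[cite: GreenbergLNM1716, §1] -/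
theorem coe_selmerModelIso_conjH1 (σ : Field.absoluteGaloisGroup L) (x : (W.baseChange L).selmerGroupOver p H') :
    ((selmerModelIso L H' W p ⟨(W.baseChange L).conjH1 p H' σ x,
        (W.baseChange L).map_conjH1_selmerGroupOver_le_holds p H' σ ⟨x, x.2, rfl⟩⟩ :
        W.selmerGroupOver p (galImage K L H')) : W.subgroupH1 p (galImage K L H')) =
      W.conjH1 p (galImage K L H') (resGal (K := K) L σ) (subgroupModelIso K L H' W p x) :=
  subgroupModelIso_conjH1 K L H' W p σ x

end Iso

end Summit.BirchSwinnertonDyer.BirchSwinnertonDyer.Theorems.SelmerBaseChange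

end
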